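import Summits.ValiantsHypothesis.ValiantsHypothesis.Theorems.MonotoneRestorationOrbitRestorationQPDerivChainAlgebra
import HarnessLib

/-!
# ΣΠΣ circuits of polynomial BOX VOLUME are quasi-polynomially orbit-restorable (unconditional)

Route MonotoneRestoration, crux `OrbitRestorationQP` (stmt-ValiantsHypothesis-18293), line `depth-three-rung`,
stub A_∞ `stub_sigmaPiSigmaValue`.  Namespace `Summit.ValiantsHypothesis.ValiantsHypothesis.Theorems.DerivativeTower`.

A product gate of a ΣΠΣ circuit over affine forms, `T = Π_{j<t} (ℓ_{w_j} + b_j)^{e_j}` (distinct forms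
collected with multiplicities), has derivative spaces of dimension at most its BOX VOLUME `Π_j (e_j + 1)`
(`finrank_derivChain_prodAffPow_le`: the chain of an affine power is a line, `derivChain_affPow_le`; Leibniz,
`…DerivChainAlgebra.lean`).  Hence (`catalecticant_restoration`):

* `boxVolume_restoration` — **for every `c` there is `c'` such that every matrix-symmetric family given at
  each level as `f n = Σ_{i<k} a_i Π_{j<t} (ℓ_{w_ij} + b_ij)^{e_ij}` with total box volume
  `Σ_i Π_j (e_ij + 1) ≤ n^c + c` satisfies `QPOrbitRestorable c' n (f n)` for all `n`.**

This stratum of A_∞ contains ΣΛΣ (`t = 1`), products of boundedly many powers, and — new — ΣΠΣ circuits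
whose product gates each involve `O(log n)` distinct affine forms of bounded multiplicity.  The residue of
A_∞ is thereby sharpened to product gates of SUPER-LOGARITHMIC support.  Honest label: a stratum; A_∞, the
crux and VP ≠ VNP remain open. [folklore]
-/

noncomputable section

open scoped Classical

-- `Summit.ValiantsHypothesis.ValiantsHypothesis.…` is the tree's single-conjunct layout (Sub = Summit).
set_option linter.dupNamespace false

namespace Summit.ValiantsHypothesis.ValiantsHypothesis.Theorems

namespace DerivativeTower

open MvPolynomial Finset Equiv OrbitRestorationQPDepthThreeRung WaringJennrich LevelStructure

variable {n : ℕ}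

/-- The chain of a constant dies after level `0`. [folklore] -/
theorem derivChain_C_succ (a : ℂ) : ∀ m : ℕ, derivChain (C a : MvPolynomial (Fin n × Fin n) ℂ) (m + 1) = ⊥
  | 0 => by
      rw [eq_bot_iff]
      refine derivChain_succ_le fun p hp x => ?_
      rw [derivChain_zero_eq, Submodule.mem_span_singleton] at hp
      obtain ⟨c, rfl⟩ := hp
      rw [← pdLin_apply, map_smul, pdLin_apply, pderiv_C, smul_zero]
      exact Submodule.zero_mem _
  | m + 1 => by
      rw [eq_bot_iff]
      refine derivChain_succ_le fun p hp x => ?_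
      rw [derivChain_C_succ a m, Submodule.mem_bot] at hp
      rw [hp, map_zero]
      exact Submodule.zero_mem _

/-- The partial derivative of an affine form is a constant. [folklore] -/
theorem pderiv_affine (x : Fin n × Fin n) (w : (Fin n × Fin n) → ℂ) (b : ℂ) :
    pderiv x (lin w + C b) = C (w x) := by
  have h : (pderiv x : Derivation ℂ (MvPolynomial (Fin n × Fin n) ℂ) (MvPolynomial (Fin n × Fin n) ℂ))
      (lin w + C b) = C (w x) := by
    rw [pderiv_eq_D, map_add, D_lin, D_C, add_zero, pair_pi_single]
  exact h

/-- **The derivative chain of a power of an affine form is a line (and dies above the exponent).**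
[folklore] -/
theorem derivChain_affPow_le (w : (Fin n × Fin n) → ℂ) (b : ℂ) (e : ℕ) :
    ∀ m : ℕ, derivChain ((lin w + C b) ^ e) m ≤
      if m ≤ e then Submodule.span ℂ {(lin w + C b) ^ (e - m)} else ⊥
  | 0 => by rw [if_pos (Nat.zero_le e), Nat.sub_zero, derivChain_zero_eq]
  | m + 1 => by
      refine derivChain_succ_le fun p hp x => ?_
      have hp' := derivChain_affPow_le w b e m hp
      by_cases hm : m + 1 ≤ e
      · rw [if_pos hm]
        rw [if_pos (by omega)] at hp'
        obtain ⟨c, rfl⟩ := Submodule.mem_span_singleton.mp hp'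
        rw [← pdLin_apply, map_smul, pdLin_apply]
        refine Submodule.smul_mem _ c ?_
        have hD : (pderiv x : Derivation ℂ (MvPolynomial (Fin n × Fin n) ℂ) (MvPolynomial (Fin n × Fin n) ℂ))
            ((lin w + C b) ^ (e - m)) = (e - m) • ((lin w + C b) ^ (e - m - 1) • C (w x)) := by
          rw [Derivation.leibniz_pow, ← pderiv_affine x w b]
        have hD' : pderiv x ((lin w + C b) ^ (e - m)) = (e - m) • ((lin w + C b) ^ (e - m - 1) • C (w x)) := hD
        rw [hD', show e - m - 1 = e - (m + 1) by omega, smul_eq_mul, mul_comm, ← smul_eq_C_mul]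
        exact nsmul_mem (Submodule.smul_mem _ _ (Submodule.mem_span_singleton_self _)) _
      · rw [if_neg hm]
        by_cases hme : m ≤ e
        · rw [if_pos hme, show e - m = 0 by omega, pow_zero] at hp'
          obtain ⟨c, rfl⟩ := Submodule.mem_span_singleton.mp hp'
          rw [← pdLin_apply, map_smul, pdLin_apply, show (1 : MvPolynomial (Fin n × Fin n) ℂ) = C 1 from C_1.symm,
            pderiv_C, smul_zero]
          exact Submodule.zero_mem _
        · rw [if_neg hme, Submodule.mem_bot] at hp'
          rw [hp', map_zero]
          exact Submodule.zero_mem _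

/-- Dimension form: the chain of an affine power has dimension `≤ 1` up to the exponent and `0` above.
[folklore] -/
theorem finrank_derivChain_affPow_le (w : (Fin n × Fin n) → ℂ) (b : ℂ) (e m : ℕ) :
    FiniteDimensional ℂ (derivChain ((lin w + C b) ^ e) m) ∧
      Module.finrank ℂ (derivChain ((lin w + C b) ^ e) m) ≤ if m ≤ e then 1 else 0 := by
  have hle := derivChain_affPow_le w b e m
  by_cases hm : m ≤ e
  · rw [if_pos hm] at hle ⊢
    haveI : FiniteDimensional ℂ (Submodule.span ℂ {(lin w + C b) ^ (e - m)}) :=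
      FiniteDimensional.span_of_finite ℂ (Set.finite_singleton _)
    refine ⟨Submodule.finiteDimensional_of_le hle, (Submodule.finrank_mono hle).trans ?_⟩
    exact (finrank_span_le_card _).trans (by simp)
  · rw [if_neg hm] at hle ⊢
    rw [le_bot_iff] at hle
    rw [hle]
    exact ⟨inferInstance, by rw [finrank_bot]⟩

/-- **Box volume bounds the catalecticant rank of a product of affine powers.** [folklore] -/
theorem finrank_derivChain_prodAffPow_le : ∀ (t : ℕ) (w : Fin t → (Fin n × Fin n) → ℂ) (b : Fin t → ℂ)
    (e : Fin t → ℕ) (m : ℕ),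
    FiniteDimensional ℂ (derivChain (∏ j, (lin (w j) + C (b j)) ^ (e j)) m) ∧
      Module.finrank ℂ (derivChain (∏ j, (lin (w j) + C (b j)) ^ (e j)) m) ≤ ∏ j, (e j + 1)
  | 0, w, b, e, m => by
      rw [Finset.univ_eq_empty, Finset.prod_empty, Finset.prod_empty,
        show (1 : MvPolynomial (Fin n × Fin n) ℂ) = C 1 from C_1.symm]
      cases m with
      | zero =>
        rw [derivChain_zero_eq]
        haveI : FiniteDimensional ℂ (Submodule.span ℂ {(C 1 : MvPolynomial (Fin n × Fin n) ℂ)}) :=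
          FiniteDimensional.span_of_finite ℂ (Set.finite_singleton _)
        exact ⟨inferInstance, (finrank_span_le_card _).trans (by simp)⟩
      | succ m =>
        rw [derivChain_C_succ]
        exact ⟨inferInstance, by rw [finrank_bot]; exact Nat.zero_le _⟩
  | t + 1, w, b, e, m => by
      rw [Fin.prod_univ_succ, Fin.prod_univ_succ]
      set g : MvPolynomial (Fin n × Fin n) ℂ := ∏ j : Fin t, (lin (w j.succ) + C (b j.succ)) ^ (e j.succ) with hg
      have ih := finrank_derivChain_prodAffPow_le t (fun j => w j.succ) (fun j => b j.succ) (fun j => e j.succ)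
      have hf := finrank_derivChain_affPow_le (w 0) (b 0) (e 0)
      have hmul := finrank_derivChain_mul_le ((lin (w 0) + C (b 0)) ^ (e 0)) g m (fun a => (hf a).1)
        (fun a => (ih a).1)
      refine ⟨hmul.1, hmul.2.trans ?_⟩
      set P := ∏ j : Fin t, (e j.succ + 1) with hP
      calc ∑ a ∈ Finset.range (m + 1), Module.finrank ℂ (derivChain ((lin (w 0) + C (b 0)) ^ e 0) a) *
              Module.finrank ℂ (derivChain g (m - a))
          ≤ ∑ a ∈ Finset.range (m + 1), (if a ≤ e 0 then P else 0) := by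
            refine Finset.sum_le_sum fun a _ => ?_
            have h1 := (hf a).2
            have h2 := (ih (m - a)).2
            by_cases ha : a ≤ e 0
            · rw [if_pos ha] at h1 ⊢
              calc _ ≤ 1 * P := Nat.mul_le_mul h1 h2
                _ = P := one_mul P
            · rw [if_neg ha] at h1 ⊢
              rw [Nat.le_zero.mp h1, zero_mul]
        _ = ∑ a ∈ (Finset.range (m + 1)).filter (fun a => a ≤ e 0), P := by rw [Finset.sum_filter]
        _ = ((Finset.range (m + 1)).filter (fun a => a ≤ e 0)).card * P := by rw [Finset.sum_const, smul_eq_mul]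
        _ ≤ (e 0 + 1) * P := by
            refine Nat.mul_le_mul_right _ ?_
            calc _ ≤ (Finset.range (e 0 + 1)).card := Finset.card_le_card fun a ha => by
                    rw [Finset.mem_filter] at ha; exact Finset.mem_range.2 (by omega)
              _ = e 0 + 1 := Finset.card_range _

/-- **Total box volume bounds the catalecticant rank of a ΣΠΣ expression over affine forms.** [folklore] -/
theorem finrank_derivChain_boxSum_le {k t : ℕ} (a : Fin k → ℂ) (w : Fin k → Fin t → (Fin n × Fin n) → ℂ)
    (b : Fin k → Fin t → ℂ) (e : Fin k → Fin t → ℕ) (m : ℕ) :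
    FiniteDimensional ℂ (derivChain (∑ i, C (a i) * ∏ j, (lin (w i j) + C (b i j)) ^ (e i j)) m) ∧
      Module.finrank ℂ (derivChain (∑ i, C (a i) * ∏ j, (lin (w i j) + C (b i j)) ^ (e i j)) m) ≤
        ∑ i, ∏ j, (e i j + 1) := by
  have hT := fun i => finrank_derivChain_prodAffPow_le t (w i) (b i) (e i) m
  have hle : derivChain (∑ i, C (a i) * ∏ j, (lin (w i j) + C (b i j)) ^ (e i j)) m ≤
      ⨆ i ∈ (Finset.univ : Finset (Fin k)), derivChain (∏ j, (lin (w i j) + C (b i j)) ^ (e i j)) m :=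
    (derivChain_sum_le _ _ m).trans (iSup₂_mono fun i _ => derivChain_C_mul_le (a i) _ m)
  obtain ⟨hfin, hsum⟩ := finrank_biSup_le_sum (Finset.univ : Finset (Fin k))
    (fun i => derivChain (∏ j, (lin (w i j) + C (b i j)) ^ (e i j)) m) (fun i _ => (hT i).1)
  haveI := hfin
  exact ⟨Submodule.finiteDimensional_of_le hle,
    (Submodule.finrank_mono hle).trans (hsum.trans (Finset.sum_le_sum fun i _ => (hT i).2))⟩

/-- **ΣΠΣ CIRCUITS OF POLYNOMIAL BOX VOLUME ARE QUASI-POLYNOMIALLY ORBIT-RESTORABLE (unconditional, one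
constant per class).**  For every `c` there is `c'` such that every matrix-symmetric family with, at every
level, `f n = Σ_{i<k} a_i Π_{j<t} (ℓ_{w_ij} + b_ij)^{e_ij}` and `Σ_i Π_j (e_ij + 1) ≤ n^c + c` satisfies
`QPOrbitRestorable c' n (f n)` for all `n`. [folklore] -/
theorem boxVolume_restoration (c : ℕ) : ∃ c' : ℕ,
    ∀ f : (n : ℕ) → MvPolynomial (Fin n × Fin n) ℂ, IsMatrixSymmetric f →
      (∀ n : ℕ, ∃ (k t : ℕ) (a : Fin k → ℂ) (w : Fin k → Fin t → (Fin n × Fin n) → ℂ) (b : Fin k → Fin t → ℂ)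
        (e : Fin k → Fin t → ℕ), (∑ i, ∏ j, (e i j + 1)) ≤ n ^ c + c ∧
          f n = ∑ i, C (a i) * ∏ j, (lin (w i j) + C (b i j)) ^ (e i j)) →
      ∀ n : ℕ, QPOrbitRestorable c' n (f n) := by
  obtain ⟨c', hc'⟩ := catalecticant_restoration c
  refine ⟨c', fun f hsym hf n => hc' f hsym (fun n m => ?_) n⟩
  obtain ⟨k, t, a, w, b, e, hvol, hfn⟩ := hf n
  have h := finrank_derivChain_boxSum_le a w b e m
  rw [← hfn] at h
  exact ⟨h.1, h.2.trans hvol⟩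

end DerivativeTower

end Summit.ValiantsHypothesis.ValiantsHypothesis.Theorems

end
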